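import Summits.NavierStokesRegularity.NavierStokesRegularity.Theorems.TypeIliouvilleNoTypeII.Negative.WithoutLerayHopfFalse
import Literature.Analysis.FluidPDE.NSSuitableESSRefutation

/-!
# `TypeIliouvilleNoTypeII` (stmt-NavierStokesRegularity-0056), line `gradient-bkm-pivot`:
# the energy class is load-bearing for EACH residual stub separately

Negative (support) lemmas for the two residual stubs of the lead skeleton
`Cruxes/TypeIliouvilleNoTypeII/Lines/gradient_bkm_pivot.lean` (rev 4, passes c2/c3) of the crux
`TypeILiouville.TypeIliouvilleNoTypeII` (= `NoTypeII`, shared by 23 routes):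

* residual **A** = `stub_gradientBKMSharp`: a maximal smooth solution with finite lifespan `T`,
  Leray–Hopf from a rapidly decaying datum, has a BKM-sharp gradient `‖∇u(t)‖_∞ ≤ C/(T − t)`;
* residual **B1** = `stub_noFastBalls`: under A's conclusion, eventually every parabolic ball
  `B(x, √(T − t))` contains a point of Type-I speed `‖u(t, y)‖ ≤ K/√(T − t)`.

Both are open (A ∧ B1 ⇔ crux, `GradientPivot.TypeIliouvilleNoTypeII_iff_gradientSharp_and_noFastBalls`).
Here: with the finite-energy hypothesis `IsLerayHopfOn T ν 0 (u 0) u` deleted — and nothing else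
changed — EACH residual is FALSE, so every proof of either half must use the energy class
(Koch–Nadirashvili–Seregin–Šverák 2009, §1 p. 3: `L^∞`-type / local information alone never controls
the time behaviour; Majda–Bertozzi 2002, §1.4: exact solutions with linear velocity).

* `gradientBKMSharp_false_without_lerayHopf` — witness: the irrotational planar **strain flow**
  `u = g(t) D x`, `D = diag(1, −1, 0)`, `p = −½(g′ + g²) x₀² + ½(g′ − g²) x₁²`, with the Type-II
  gradient amplitude `g(t) = ((1 − t)⁻¹ − 1)(1 − t)⁻¹`: classical on `[0, 1) × ℝ³` for every viscosity
  (`strain_isClassical`), datum `0`, no classical extension past `1` (`‖u(t, e₀)‖ = g(t) → ∞`), and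
  `‖∇u(t)‖ ≥ g(t) ≫ C/(1 − t)`.
* `noFastBalls_false_without_lerayHopf` — witness: the KNSS drift `u = g(t) e₀`, `g = (1 − t)⁻¹ − 1`
  of `Negative/WithoutLerayHopfFalse.lean` (`∇u ≡ 0`, so A's conclusion holds with `C₁ = 0`, while no
  ball contains a Type-I-slow point).
* `not_hasSmoothExtensionPast_one_of_tendsto_norm` — the general no-extension lemma behind both
  witnesses (blow-up of `‖u(t, x₀)‖` at ONE point forbids a classical extension).
[cite: KochNadirashviliSereginSverak2009, §1 p. 3 (parasitic solutions)]
[cite: MajdaBertozzi2002, §1.4 (exact solutions with linear velocity field)]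
-/

noncomputable section

namespace Summit.NavierStokesRegularity.NavierStokesRegularity.Theorems.TypeIliouvilleNoTypeIINegative

-- the summit and its single problem share the name `NavierStokesRegularity` (D-0017 nested layout)
set_option linter.dupNamespace false

open Set Filter Topology Function Metric
open scoped ContDiff InnerProductSpace RealInnerProductSpace Laplacian
open Literature.Analysis.FluidPDE
open Summit.NavierStokesRegularity.NavierStokesRegularity.Theorems.RungReynoldsOneNegative

local notation "ℝ³" => EuclideanSpace ℝ (Fin 3)

/-! ## No classical extension past a one-point blow-up -/

/-- **One-point blow-up forbids a classical extension.** If `‖u(t, x₀)‖ → ∞` as `t ↑ 1` for some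
point `x₀`, then `u` has no classical extension past `T = 1`: an extension `u'` on `[0, T') × ℝ³`,
`T' > 1`, is continuous at `(1, x₀)` and agrees with `u` on `[0, 1)`. (The drift lemma
`drift_not_hasSmoothExtensionPast` is the case `x₀ = 0` of a spatially constant field.) [folklore] -/
theorem not_hasSmoothExtensionPast_one_of_tendsto_norm {ν : ℝ} {u : ℝ → ℝ³ → ℝ³} (x₀ : ℝ³)
    (hlim : Tendsto (fun t => ‖u t x₀‖) (𝓝[<] (1 : ℝ)) atTop) :
    ¬ HasSmoothExtensionPast ν 0 u 1 := by
  rintro ⟨T', hT', u', p', hcl, hagree⟩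
  set F : Filter ℝ := 𝓝[Ico 0 1] (1 : ℝ) with hF
  haveI : F.NeBot := by
    refine mem_closure_iff_nhdsWithin_neBot.1 ?_
    rw [closure_Ico zero_ne_one]
    exact right_mem_Icc.2 zero_le_one
  have hcont : ContinuousWithinAt (uncurry u') (Ico 0 T' ×ˢ univ) ((1 : ℝ), x₀) :=
    (hcl.smooth_velocity ((1 : ℝ), x₀) ⟨⟨zero_le_one, hT'⟩, mem_univ _⟩).continuousWithinAt
  have hmap : Tendsto (fun t : ℝ => ((t, x₀) : ℝ × ℝ³)) F
      (𝓝[Ico 0 T' ×ˢ univ] ((1 : ℝ), x₀)) := by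
    refine tendsto_nhdsWithin_iff.2 ⟨?_, ?_⟩
    · have hc : Continuous (fun t : ℝ => ((t, x₀) : ℝ × ℝ³)) :=
        continuous_id.prodMk continuous_const
      exact (hc.tendsto 1).mono_left nhdsWithin_le_nhds
    · filter_upwards [self_mem_nhdsWithin] with t ht
      exact mk_mem_prod ⟨ht.1, ht.2.trans hT'⟩ (mem_univ _)
  have hlim1 : Tendsto (fun t : ℝ => uncurry u' (t, x₀)) F (𝓝 (u' 1 x₀)) := hcont.tendsto.comp hmap
  have hlim2 : Tendsto (fun t : ℝ => u t x₀) F (𝓝 (u' 1 x₀)) := by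
    refine hlim1.congr' ?_
    filter_upwards [self_mem_nhdsWithin] with t ht
    simp [uncurry, hagree t ht]
  have hF_le : F ≤ 𝓝[<] (1 : ℝ) := nhdsWithin_mono _ fun t ht => ht.2
  exact not_tendsto_atTop_of_tendsto_nhds hlim2.norm (hlim.mono_left hF_le)

/-! ## The planar strain `D = diag(1, −1, 0)` -/

/-- `e₀ = (1, 0, 0)`. -/
def ex : ℝ³ := EuclideanSpace.single 0 1

/-- `e₁ = (0, 1, 0)`. -/
def ey : ℝ³ := EuclideanSpace.single 1 1

/-- The planar strain `D x = x₀ e₀ − x₁ e₁ = (x₀, −x₁, 0)` (trace-free, symmetric), as a continuous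
linear map. -/
def strainD : ℝ³ →L[ℝ] ℝ³ := (innerSL ℝ ex).smulRight ex - (innerSL ℝ ey).smulRight ey

/-- `D x = x₀ e₀ − x₁ e₁`. [folklore] -/
theorem strainD_apply (x : ℝ³) : strainD x = x 0 • ex - x 1 • ey := by
  simp [strainD, ex, ey, ContinuousLinearMap.smulRight_apply, EuclideanSpace.inner_single_left]

/-- Coordinates of `D x = (x₀, −x₁, 0)`. [folklore] -/
@[simp] theorem strainD_apply_zero (x : ℝ³) : strainD x 0 = x 0 := by
  simp [strainD_apply, ex, ey]

/-- Coordinates of `D x = (x₀, −x₁, 0)`. [folklore] -/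
@[simp] theorem strainD_apply_one (x : ℝ³) : strainD x 1 = -x 1 := by
  simp [strainD_apply, ex, ey]

/-- Coordinates of `D x = (x₀, −x₁, 0)`. [folklore] -/
@[simp] theorem strainD_apply_two (x : ℝ³) : strainD x 2 = 0 := by
  simp [strainD_apply, ex, ey]

/-- `D² x = x₀ e₀ + x₁ e₁` (the projection onto the `x₀x₁`-plane). [folklore] -/
theorem strainD_strainD (x : ℝ³) : strainD (strainD x) = x 0 • ex + x 1 • ey := by
  rw [strainD_apply (strainD x), strainD_apply_zero, strainD_apply_one, neg_smul, sub_neg_eq_add]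

/-- `D e₀ = e₀`. [folklore] -/
theorem strainD_ex : strainD ex = ex := by
  rw [strainD_apply]
  simp [ex, ey]

/-- `1 ≤ ‖D‖` (`D e₀ = e₀`, `‖e₀‖ = 1`). [folklore] -/
theorem one_le_norm_strainD : 1 ≤ ‖strainD‖ := by
  have h := strainD.le_opNorm ex
  have hex : ‖ex‖ = 1 := by simp [ex]
  rwa [strainD_ex, hex, mul_one] at h

/-! ## The strain flow `u = g(t) D x`, `p = −½(g′ + g²) x₀² + ½(g′ − g²) x₁²` -/

/-- The strain velocity `u(t, x) = g(t) D x` (irrotational, harmonic, divergence free). -/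
def strain (g : ℝ → ℝ) : ℝ → ℝ³ → ℝ³ := fun t x => g t • strainD x

/-- The strain pressure `p(t, x) = −½(g′(t) + g(t)²) x₀² + ½(g′(t) − g(t)²) x₁²`
(`= −½ xᵀ(Ṁ + M²)x` for `M = g D`; Majda–Bertozzi 2002, §1.4). -/
def strainP (g : ℝ → ℝ) : ℝ → ℝ³ → ℝ := fun t x =>
  -((deriv g t + g t ^ 2) / 2) * (x 0) ^ 2 + ((deriv g t - g t ^ 2) / 2) * (x 1) ^ 2

section Strain

variable {g : ℝ → ℝ}

/-- The time slices of the strain flow are the linear maps `g(t) D`. [folklore] -/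
theorem strain_eq (g : ℝ → ℝ) (t : ℝ) : strain g t = ⇑(g t • strainD) := rfl

/-- A strain flow with `g 0 = 0` starts from the zero datum. [folklore] -/
theorem strain_zero (h0 : g 0 = 0) : strain g 0 = 0 := by
  funext x
  simp [strain, h0]

/-- `‖u(t, e₀)‖ = |g(t)|`. [folklore] -/
theorem norm_strain_ex (g : ℝ → ℝ) (t : ℝ) : ‖strain g t ex‖ = |g t| := by
  have hex : ‖ex‖ = 1 := by simp [ex]
  simp [strain, strainD_ex, norm_smul, hex]

/-- `∇u(t) ≡ g(t) D`. [folklore] -/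
theorem fderiv_strain (g : ℝ → ℝ) (t : ℝ) (x : ℝ³) : fderiv ℝ (strain g t) x = g t • strainD := by
  rw [strain_eq, ContinuousLinearMap.fderiv]

/-- `|g(t)| ≤ ‖∇u(t, x)‖` (indeed `‖∇u(t, x)‖ = |g(t)| ‖D‖` and `‖D‖ ≥ 1`). [folklore] -/
theorem abs_le_norm_fderiv_strain (g : ℝ → ℝ) (t : ℝ) (x : ℝ³) :
    |g t| ≤ ‖fderiv ℝ (strain g t) x‖ := by
  rw [fderiv_strain, norm_smul, Real.norm_eq_abs]
  calc |g t| = |g t| * 1 := (mul_one _).symm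
    _ ≤ |g t| * ‖strainD‖ := mul_le_mul_of_nonneg_left one_le_norm_strainD (abs_nonneg _)

/-- The derivative of the quadratic pressure slice. [folklore] -/
theorem hasFDerivAt_strainP (g : ℝ → ℝ) (t : ℝ) (x : ℝ³) :
    HasFDerivAt (strainP g t)
      ((-((deriv g t + g t ^ 2) / 2)) • ((2 • (x 0) ^ (2 - 1)) • (EuclideanSpace.proj 0 : ℝ³ →L[ℝ] ℝ)) +
        ((deriv g t - g t ^ 2) / 2) • ((2 • (x 1) ^ (2 - 1)) • (EuclideanSpace.proj 1 : ℝ³ →L[ℝ] ℝ))) x := by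
  have h0 : HasFDerivAt (fun y : ℝ³ => y 0) (EuclideanSpace.proj 0 : ℝ³ →L[ℝ] ℝ) x :=
    PiLp.hasFDerivAt_apply 2 x 0
  have h1 : HasFDerivAt (fun y : ℝ³ => y 1) (EuclideanSpace.proj 1 : ℝ³ →L[ℝ] ℝ) x :=
    PiLp.hasFDerivAt_apply 2 x 1
  exact ((h0.pow 2).const_mul _).add ((h1.pow 2).const_mul _)

/-- `∇p(t, x) = −(g′ + g²) x₀ e₀ + (g′ − g²) x₁ e₁`. [folklore] -/
theorem gradient_strainP (g : ℝ → ℝ) (t : ℝ) (x : ℝ³) :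
    gradient (strainP g t) x =
      (-(deriv g t + g t ^ 2) * x 0) • ex + ((deriv g t - g t ^ 2) * x 1) • ey := by
  have hP : HasFDerivAt (strainP g t)
      (InnerProductSpace.toDual ℝ ℝ³
        ((-(deriv g t + g t ^ 2) * x 0) • ex + ((deriv g t - g t ^ 2) * x 1) • ey)) x := by
    refine (hasFDerivAt_strainP g t x).congr_fderiv (ContinuousLinearMap.ext fun h => ?_)
    simp only [add_apply, FunLike.coe_smul, Pi.smul_apply,
      InnerProductSpace.toDual_apply_apply, inner_add_left, inner_smul_left, ex, ey,
      EuclideanSpace.inner_single_left, smul_eq_mul, map_one, one_mul, conj_trivial, pow_one,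
      Nat.add_one_sub_one, nsmul_eq_mul, Nat.cast_ofNat, PiLp.proj_apply]
    ring
  exact (hasGradientAt_iff_hasFDerivAt.mpr hP).gradient

/-- `div u(t) = g(t) tr D = 0`. [folklore] -/
theorem divergence_strain (g : ℝ → ℝ) (t : ℝ) (x : ℝ³) :
    VectorCalculus.divergence (strain g t) x = 0 := by
  rw [divergence_eq_sum_inner_fderiv (EuclideanSpace.basisFun (Fin 3) ℝ), fderiv_strain,
    Fin.sum_univ_three]
  simp only [EuclideanSpace.basisFun_apply, EuclideanSpace.inner_single_left, map_one, one_mul,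
    FunLike.coe_smul, Pi.smul_apply, PiLp.smul_apply, smul_eq_mul,
    strainD_apply_zero, strainD_apply_one, strainD_apply_two, PiLp.single_apply]
  simp

/-- **Every strain flow is a classical solution** of unforced Navier–Stokes on `[0, 1) × ℝ³`, for
every viscosity, as soon as the amplitude is smooth on `(-∞, 1)`: `∂ₜu = g′ D x`,
`(u·∇)u = g² D² x`, `Δu = 0`, `−∇p = g′ D x + g² D² x`, `div u = 0` (Majda–Bertozzi 2002, §1.4).
[cite: MajdaBertozzi2002, §1.4 (exact solutions with linear velocity field)] -/
theorem strain_isClassical (hg : ContDiffOn ℝ ∞ g (Iio 1)) (ν : ℝ) :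
    IsClassicalNSSolutionOn (Ico 0 1) ν 0 (strain g) (strainP g) where
  smooth_velocity := by
    show ContDiffOn ℝ ∞ (fun z : ℝ × ℝ³ => g z.1 • strainD z.2) (Ico 0 1 ×ˢ univ)
    have h1 : ContDiffOn ℝ ∞ (fun z : ℝ × ℝ³ => g z.1) (Ico 0 1 ×ˢ univ) :=
      hg.comp contDiffOn_fst fun z hz => (mem_prod.1 hz).1.2
    exact h1.smul (strainD.contDiff.comp contDiff_snd).contDiffOn
  smooth_pressure := by
    show ContDiffOn ℝ ∞ (fun z : ℝ × ℝ³ => -((deriv g z.1 + g z.1 ^ 2) / 2) * (z.2 0) ^ 2 +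
      ((deriv g z.1 - g z.1 ^ 2) / 2) * (z.2 1) ^ 2) (Ico 0 1 ×ˢ univ)
    have hg1 : ContDiffOn ℝ ∞ (fun z : ℝ × ℝ³ => g z.1) (Ico 0 1 ×ˢ univ) :=
      hg.comp contDiffOn_fst fun z hz => (mem_prod.1 hz).1.2
    have hd' : ContDiffOn ℝ ∞ (deriv g) (Iio 1) :=
      ((contDiffOn_infty_iff_deriv_of_isOpen isOpen_Iio).1 hg).2
    have hd : ContDiffOn ℝ ∞ (fun z : ℝ × ℝ³ => deriv g z.1) (Ico 0 1 ×ˢ univ) :=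
      hd'.comp contDiffOn_fst fun z hz => (mem_prod.1 hz).1.2
    have h0 : ContDiffOn ℝ ∞ (fun z : ℝ × ℝ³ => z.2 0) (Ico 0 1 ×ˢ univ) :=
      ((contDiff_piLp_apply (p := 2) (i := (0 : Fin 3))).comp contDiff_snd).contDiffOn
    have h1 : ContDiffOn ℝ ∞ (fun z : ℝ × ℝ³ => z.2 1) (Ico 0 1 ×ˢ univ) :=
      ((contDiff_piLp_apply (p := 2) (i := (1 : Fin 3))).comp contDiff_snd).contDiffOn
    exact ((((hd.add (hg1.pow 2)).div_const 2).neg.mul (h0.pow 2)).add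
      (((hd.sub (hg1.pow 2)).div_const 2).mul (h1.pow 2)))
  momentum t ht x := by
    have hga : HasDerivAt g (deriv g t) t :=
      (((hg t ht.2).contDiffAt (Iio_mem_nhds ht.2)).differentiableAt (by simp)).hasDerivAt
    have hderiv : timeDerivWithin (Ico 0 1) (strain g) t x = deriv g t • strainD x := by
      simp only [timeDerivWithin_apply, strain]
      exact (hga.smul_const (strainD x)).hasDerivWithinAt.derivWithin (uniqueDiffOn_Ico 0 1 t ht)
    have hconv : convect (strain g t) (strain g t) x = (g t * g t) • (x 0 • ex + x 1 • ey) := by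
      rw [convect_apply, fderiv_strain, strain_eq, smul_apply, smul_apply, map_smul, strainD_strainD,
        smul_smul]
    have hlap : (Δ (strain g t)) x = 0 := by
      rw [strain_eq]
      exact laplacian_clm_apply _ x
    rw [hderiv, hconv, hlap, gradient_strainP, strainD_apply]
    ext i
    fin_cases i <;> simp [ex, ey] <;> ring
  divFree t _ x := divergence_strain g t x

/-- A strain flow with `g(0) = 0` starts from the datum `0`, which is rapidly decaying. [folklore] -/
theorem strain_rapidDecay (h0 : g 0 = 0) : HasRapidSpatialDecay (strain g 0) := by
  rw [strain_zero h0]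
  intro n K
  refine ⟨0, fun x => ?_⟩
  have h : (0 : ℝ³ → ℝ³) = fun _ => (0 : ℝ³) := rfl
  rw [h, iteratedFDeriv_fun_zero]
  simp

/-- **A strain flow with unbounded amplitude is a maximal smooth solution with lifespan `1`**, for
every viscosity: classical on `[0, 1) × ℝ³`, and `‖u(t, e₀)‖ = |g(t)| → ∞` forbids a classical
extension past `1`. [folklore] -/
theorem strain_isMaximalSmoothSolution (hg : ContDiffOn ℝ ∞ g (Iio 1))
    (hlim : Tendsto (fun t => |g t|) (𝓝[<] (1 : ℝ)) atTop) (ν : ℝ) :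
    IsMaximalSmoothSolution ν 0 (strain g) (strainP g) 1 :=
  ⟨strain_isClassical hg ν,
    not_hasSmoothExtensionPast_one_of_tendsto_norm ex (by simpa only [norm_strain_ex] using hlim)⟩

end Strain

/-! ## The Type-II gradient amplitude `g(t) = ((1 − t)⁻¹ − 1)(1 − t)⁻¹` -/

/-! Written inline as `fun s : ℝ => ((1 - s)⁻¹ - 1) * (1 - s)⁻¹` (no auxiliary definition), on top of
the Type-II drift amplitude `(1 − s)⁻¹ − 1` of `Negative/WithoutLerayHopfFalse.lean`: smooth on
`(-∞, 1)`, vanishes at `0`, and `(1 − t) g(t) = (1 − t)⁻¹ − 1 → ∞`, so `g` beats every `C/(1 − t)`. -/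

/-- `g(0) = 0`. [folklore] -/
theorem gIIgrad_zero : (((1 : ℝ) - 0)⁻¹ - 1) * ((1 : ℝ) - 0)⁻¹ = 0 := by simp

/-- `g` is smooth on `(-∞, 1)`. [folklore] -/
theorem gIIgrad_contDiffOn :
    ContDiffOn ℝ ∞ (fun s : ℝ => ((1 - s)⁻¹ - 1) * (1 - s)⁻¹) (Iio 1) :=
  gII_contDiffOn.mul ((contDiffOn_const.sub contDiffOn_id).inv fun t ht =>
    (sub_pos.2 (show t < 1 from ht)).ne')

/-- On `[0, 1)` the gradient amplitude dominates the drift amplitude: `(1 − t)⁻¹ − 1 ≤ g(t)`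
(since `(1 − t)⁻¹ ≥ 1`). [folklore] -/
theorem gII_le_gIIgrad {t : ℝ} (ht0 : 0 ≤ t) (ht : t < 1) :
    (1 - t)⁻¹ - 1 ≤ ((1 - t)⁻¹ - 1) * (1 - t)⁻¹ := by
  have h1 : 0 < 1 - t := sub_pos.2 ht
  have h2 : 1 ≤ (1 - t)⁻¹ := by
    rw [le_inv_comm₀ one_pos h1, inv_one]
    linarith
  have h3 : 0 ≤ (1 - t)⁻¹ - 1 := gII_nonneg ht0 ht
  nlinarith

/-- `g ≥ 0` on `[0, 1)`. [folklore] -/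
theorem gIIgrad_nonneg {t : ℝ} (ht0 : 0 ≤ t) (ht : t < 1) :
    0 ≤ ((1 - t)⁻¹ - 1) * (1 - t)⁻¹ :=
  mul_nonneg (gII_nonneg ht0 ht) (inv_nonneg.2 (sub_pos.2 ht).le)

/-- `|g| → ∞` as `t ↑ 1`. [folklore] -/
theorem tendsto_abs_gIIgrad_atTop :
    Tendsto (fun t : ℝ => |((1 - t)⁻¹ - 1) * (1 - t)⁻¹|) (𝓝[<] (1 : ℝ)) atTop := by
  refine tendsto_atTop_mono' _ ?_ tendsto_gII_atTop
  filter_upwards [Ioo_mem_nhdsLT one_pos] with t ht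
  exact (gII_le_gIIgrad ht.1.le ht.2).trans (le_abs_self _)

/-- The Type-II-gradient strain flow is a maximal smooth solution with lifespan `1`, for every
viscosity. [folklore] -/
theorem strain_gIIgrad_isMaximalSmoothSolution (ν : ℝ) :
    IsMaximalSmoothSolution ν 0 (strain fun s : ℝ => ((1 - s)⁻¹ - 1) * (1 - s)⁻¹)
      (strainP fun s : ℝ => ((1 - s)⁻¹ - 1) * (1 - s)⁻¹) 1 :=
  strain_isMaximalSmoothSolution gIIgrad_contDiffOn tendsto_abs_gIIgrad_atTop ν

/-! ## (A) Residual A without the energy class is false -/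

/-- **Finite energy is load-bearing for residual A (`GradientBKMSharp`).**  The registered stub
`GradientPivot.stub_gradientBKMSharp` of line `gradient-bkm-pivot` with its hypothesis
`IsLerayHopfOn T ν 0 (u 0) u` deleted — and nothing else changed — is FALSE: at `ν = T = 1` the
strain flow `u = g(t)(x₀, −x₁, 0)`, `g(t) = ((1 − t)⁻¹ − 1)(1 − t)⁻¹`, is a maximal smooth solution
(`strain_gIIgrad_isMaximalSmoothSolution`) from the rapidly decaying datum `0`
(`strain_rapidDecay`), while `‖∇u(t, x)‖ ≥ g(t)` and `(1 − t) g(t) = (1 − t)⁻¹ − 1 → ∞`, so no bound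
`‖∇u(t)‖_∞ ≤ C/(1 − t)` holds near `t = 1`.  Hence a proof of A must use the energy class, exactly
as for the crux itself (`typeIliouvilleNoTypeII_false_without_lerayHopf`); note the witness is
irrotational, so it does NOT test the vorticity form A′ (`‖curl u(t)‖_∞ ≤ C/(T − t)`).
[cite: MajdaBertozzi2002, §1.4 (exact solutions with linear velocity field)] -/
theorem gradientBKMSharp_false_without_lerayHopf :
    ¬ (∀ (ν T : ℝ), 0 < ν → 0 < T → ∀ (u : ℝ → ℝ³ → ℝ³) (p : ℝ → ℝ³ → ℝ),
        IsMaximalSmoothSolution ν 0 u p T → HasRapidSpatialDecay (u 0) →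
        ∃ C : ℝ, ∀ᶠ t in 𝓝[<] T, ∀ x, ‖fderiv ℝ (u t) x‖ ≤ C / (T - t)) := by
  intro h
  obtain ⟨C, hC⟩ := h 1 1 one_pos one_pos _ _ (strain_gIIgrad_isMaximalSmoothSolution 1)
    (strain_rapidDecay gIIgrad_zero)
  have h2 : ∀ᶠ t in 𝓝[<] (1 : ℝ), t ∈ Ioo (0 : ℝ) 1 := Ioo_mem_nhdsLT one_pos
  have h3 : ∀ᶠ t in 𝓝[<] (1 : ℝ), C < (1 - t)⁻¹ - 1 :=
    tendsto_gII_atTop.eventually (eventually_gt_atTop C)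
  obtain ⟨t, ht, ht2, ht3⟩ := (hC.and (h2.and h3)).exists
  have ht1 : t < 1 := ht2.2
  have h1t : 0 < 1 - t := sub_pos.2 ht1
  -- `g(t) ≤ ‖∇u(t, 0)‖ ≤ C/(1 − t)`
  have hle : ((1 - t)⁻¹ - 1) * (1 - t)⁻¹ ≤ C / (1 - t) := by
    have := (abs_le_norm_fderiv_strain (fun s : ℝ => ((1 - s)⁻¹ - 1) * (1 - s)⁻¹) t 0).trans (ht 0)
    rwa [abs_of_nonneg (gIIgrad_nonneg ht2.1.le ht1)] at this
  -- multiply by `1 − t > 0`: `(1 − t)⁻¹ − 1 ≤ C`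
  have key : (1 - t)⁻¹ - 1 ≤ C := by
    have hmul := mul_le_mul_of_nonneg_left hle h1t.le
    have hl : (1 - t) * (((1 - t)⁻¹ - 1) * (1 - t)⁻¹) = (1 - t)⁻¹ - 1 := by
      field_simp
    have hr : (1 - t) * (C / (1 - t)) = C := by
      field_simp
    rwa [hl, hr] at hmul
  linarith

/-! ## (B1) Residual B1 without the energy class is false -/

/-- **Finite energy is load-bearing for residual B1 (`NoFastBalls`).**  The registered stub
`GradientPivot.stub_noFastBalls` of line `gradient-bkm-pivot` with its hypothesis
`IsLerayHopfOn T ν 0 (u 0) u` deleted — and nothing else changed, in particular KEEPING the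
gradient-sharpness hypothesis — is FALSE: at `ν = T = 1` the Type-II drift `u = g(t) e₀`,
`g(t) = (1 − t)⁻¹ − 1` (KNSS 2009, §1 p. 3) is a maximal smooth solution from the datum `0`
(`drift_gII_isMaximalSmoothSolution`, `drift_rapidDecay`) with `∇u ≡ 0` (gradient-sharp with
`C₁ = 0`), but `‖u(t, y)‖ = g(t)` at EVERY point, so a Type-I-slow point in every parabolic ball
would make the drift Type I, contradicting `drift_gII_not_isTypeIBlowup`.  Hence B1, like A and like
the crux, can only be proved inside the energy class; and since the provable stub 7
(`stub_typeI_of_noFastBalls`) uses no energy, the finite-energy content of the crux sits in B1.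
[cite: KochNadirashviliSereginSverak2009, §1 p. 3 (parasitic solutions)] -/
theorem noFastBalls_false_without_lerayHopf :
    ¬ (∀ (ν T : ℝ), 0 < ν → 0 < T → ∀ (u : ℝ → ℝ³ → ℝ³) (p : ℝ → ℝ³ → ℝ),
        IsMaximalSmoothSolution ν 0 u p T → HasRapidSpatialDecay (u 0) →
        (∃ C₁ : ℝ, ∀ᶠ t in 𝓝[<] T, ∀ x, ‖fderiv ℝ (u t) x‖ ≤ C₁ / (T - t)) →
        ∃ K : ℝ, ∀ᶠ t in 𝓝[<] T, ∀ x : ℝ³, ∃ y ∈ ball x (Real.sqrt (T - t)),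
          ‖u t y‖ ≤ K / Real.sqrt (T - t)) := by
  intro h
  have hG : ∃ C₁ : ℝ, ∀ᶠ t in 𝓝[<] (1 : ℝ), ∀ x : ℝ³,
      ‖fderiv ℝ (drift (fun s : ℝ => (1 - s)⁻¹ - 1) t) x‖ ≤ C₁ / (1 - t) := by
    refine ⟨0, Eventually.of_forall fun t x => ?_⟩
    rw [drift_apply]
    simp
  obtain ⟨K, hK⟩ := h 1 1 one_pos one_pos _ _ (drift_gII_isMaximalSmoothSolution 1)
    (drift_rapidDecay gII_zero) hG
  refine drift_gII_not_isTypeIBlowup ⟨K, ?_⟩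
  filter_upwards [hK] with t ht x
  obtain ⟨y, -, hy⟩ := ht x
  rw [norm_drift] at hy ⊢
  exact hy

end Summit.NavierStokesRegularity.NavierStokesRegularity.Theorems.TypeIliouvilleNoTypeIINegative

end
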